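import Summits.HodgeConjecture.HodgeConjecture.Theorems.VHCAbelianSchemesRoadDiagonalSingleCellCM
import Summits.HodgeConjecture.HodgeConjecture.Theses.VHCAbelianSchemesRoad
import HarnessLib

/-!
# Road b02 (`VHCAbelianSchemesRoad`, D-0059) — «no load-bearing cell» stated ON THE ROUTE DECLS: the leaf `HC_AV` from the binders of
# `closes` with the crux replaced by ANY TAIL / ANY INFINITE SET of diagonal cells; `HCAtDim g` from `HC_CM` and ONE cell

research route conditional on HC_CM; not a corollary; Q11.4-sentence-2 already refuted in dim ≥ 3.
(cell line of seat ab-andre-2: research route, not a corollary; conditional on HC_CM plus one named minimal statement.)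

THEOREMS ONLY (no definition, no named fact, no sorry; nothing of the road's research content is claimed; `HC_CM` is an explicit
HYPOTHESIS of §3, the route decl `Theses.RankFourFaces.CMAbelianHodge`). Seat ab-andre-2 gen 56, PART Y-d: the companion files
`VHCAbelianSchemesRoadDiagonalTail.lean` (p469169) / `…DiagonalSingleCell.lean` (p469584) / `…DiagonalSingleCellCM.lean` prove the
statements over the carrier's constants; this CLOSER-type file imports the ROUTE FILE (rev 12) and restates them with the hypotheses
LITERALLY the route decls of `Theses.VHCAbelianSchemesRoad` (admissibility notion AdmTw spelled out), for the LEAD's option-(α) edit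
and the tribunal's ROUND 2:
* §1 `twAtDiag_ge_of_semiregularSheafRepresentativesTwAt`, `twAtDiag_frequently_of_ge` — item 19274 ⟹ every tail ⟹ «infinitely many
  cells» (C → S bookkeeping: each is a WEAKER hypothesis than the previous);
* §2 `hc_av_of_twAtDiag_ge` — `HC_AV` from `ChernCharacterOnBetti`, ANY TAIL `m ≥ M₀` of the diagonal slice, `TwistedPerfectDoor`,
  `RaynaudSectionProjective`, `AndreCMAnchoredPencil`, `AndreAnchoredPencilsAlgebraic` — EVERY `M₀`, FACT-FREE (part X-c's
  `hc_av_of_twAtDiag_two` is `M₀ = 2`; its `…_of_hodgeAbelianDimLeFive_of_twAtDiag_three` loses the residual; its `HC_CM` chains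
  `…_of_cmAbelianHodge_of_twAtDiag_four/_six/_eight` lose `HC_CM`); `hc_av_of_twAtDiag_frequently` — from INFINITELY MANY cells;
  `hc_av_of_twAtDiagTail_four` — from the option-(α) candidate skeleton's TAIL STUB statement alone (`∀ C m, 4 ≤ m → …`);
* §3 `hcAtDim_of_cmAbelianHodge_of_twAtCell` — `HCAtDim g` from `HC_CM`, ONE cell `(2M, M)` with `M + 2 ≥ 2g`, K-C, the door,
  Raynaud, Lemme 6.3.1 (what `HC_CM` buys: one cell per dimension; for `HC_AV` it is idle, §2);
* §4 (appended after the round-2 edit, rev 13/14): the NEW crux decl `SemiregularSheafRepresentativesTwAtDiag` (item 19787) BY NAME ⟹ every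
  tail ⟹ infinitely many cells; `HCAtDim g` from it with `HC_CM`.
(The filed `Assembly`, item 19539, is closed — `vhcAbelianSchemesRoad_assembly_proof`, `assembly_of_diag` — and is not restated; through
the tail it reads `hc_av_of_twAtDiag_ge hC 4 (twAtDiag_ge_of_semiregularSheafRepresentativesTwAt hTw 4) …`.)

References: [Andre1996Motifs] §6.3; [BrosnanFangNiePearlstein2009] §6 Lemma 48; [Fulton1998] §10.1; [Lieberman1968];
[Pridham2024Semiregularity] Cor. 2.25, Rem. 2.27; [GortzWedhorn2023] Thm. 27.291; [BuchweitzFlenner2003] §5 Thm. 5.1; [Milne1999] §7.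
-/

noncomputable section

open CategoryTheory CategoryTheory.Limits AlgebraicGeometry Topology

namespace Summit.HodgeConjecture.HodgeConjecture.Ring2.SemiregularRepresentatives

set_option linter.dupNamespace false -- the cell's namespace repeats the summit name, as in every `Ring2*` file

open Literature.AlgebraicGeometry Literature.AlgebraicGeometry.Motives Literature.AlgebraicGeometry.HodgeTheory
open Literature.AlgebraicTopology.SingularHomology
open Summit.HodgeConjecture.HodgeConjecture.Ring2.ClassTargets (HCAtDim)

/-- The route's admissibility notion AdmTw contains Buchweitz–Flenner's single-sheaf notion (right disjunct). [folklore] -/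
private theorem admTw_of_bfSingle' :
    ∀ n X₀ I E, Literature.AlgebraicGeometry.HodgeTheory.bfSingleAdmissible n X₀ I E →
      (fun n X₀ I E => Summit.Ventures.HSemireg.gluableSigmaAdmissible n X₀ I E ∨
        Literature.AlgebraicGeometry.HodgeTheory.bfSingleAdmissible n X₀ I E) n X₀ I E :=
  fun _ _ _ _ h => Or.inr h

/-! ## §1 C → S bookkeeping: the crux as filed ⟹ every tail ⟹ infinitely many cells -/

/-- **Item 19274 implies every tail of its diagonal slice** (the crux quantifies over all `(n, p)`; a tail keeps the cells `(2m, m)`,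
`m ≥ M₀`). [cite: Bloch1972Semiregularity, Remark (7.5)] [cite: BuchweitzFlenner2003, §5 Thm. 5.1] -/
theorem twAtDiag_ge_of_semiregularSheafRepresentativesTwAt (h : Theses.VHCAbelianSchemesRoad.SemiregularSheafRepresentativesTwAt)
    (M₀ : ℕ) : ∀ (C : ChernCharacterBetti) (m : ℕ), M₀ ≤ m →
      LefAtExceptionalRegimeAt (Literature.AlgebraicGeometry.HodgeTheory.twistedReflexiveClass C
        (fun n X₀ I E => Summit.Ventures.HSemireg.gluableSigmaAdmissible n X₀ I E ∨
          Literature.AlgebraicGeometry.HodgeTheory.bfSingleAdmissible n X₀ I E)) (2 * m) m :=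
  fun C m _ =>
    lefAtExceptionalRegimeAt_of_admissibleRepresentativesLefAtDeg (admissibleRepresentativesLefAt_iff_forall_deg.1 (h C) (2 * m) m)

/-- **Every tail of the diagonal slice is an infinite set of cells** (per Chern character theory). [folklore] -/
theorem twAtDiag_frequently_of_ge {M₀ : ℕ}
    (h : ∀ (C : ChernCharacterBetti) (m : ℕ), M₀ ≤ m →
      LefAtExceptionalRegimeAt (Literature.AlgebraicGeometry.HodgeTheory.twistedReflexiveClass C
        (fun n X₀ I E => Summit.Ventures.HSemireg.gluableSigmaAdmissible n X₀ I E ∨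
          Literature.AlgebraicGeometry.HodgeTheory.bfSingleAdmissible n X₀ I E)) (2 * m) m) :
    ∀ (C : ChernCharacterBetti) (M : ℕ), ∃ m : ℕ, M ≤ m ∧
      LefAtExceptionalRegimeAt (Literature.AlgebraicGeometry.HodgeTheory.twistedReflexiveClass C
        (fun n X₀ I E => Summit.Ventures.HSemireg.gluableSigmaAdmissible n X₀ I E ∨
          Literature.AlgebraicGeometry.HodgeTheory.bfSingleAdmissible n X₀ I E)) (2 * m) m :=
  fun C M => ⟨max M M₀, le_max_left _ _, h C _ (le_max_right _ _)⟩

/-! ## §2 `HC_AV` from the binders of `closes` with the crux replaced by ANY TAIL / INFINITELY MANY cells of its diagonal -/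

/-- **`HC_AV` from the six binders of `Theses.VHCAbelianSchemesRoad.closes` with `SemiregularSheafRepresentativesTwAt` replaced by ANY TAIL
`m ≥ M₀` of its diagonal slice** — EVERY `M₀`, FACT-FREE beyond the displayed route decls (K-C, twisted door, Raynaud, André #21/#22); no
`HC_CM`, no `HodgeAbelianDimLeFive`. In particular neither the cell `(4, 2)` nor the BC5 rung `(6, 3)` of the option-(α) crux is
load-bearing for the leaf. [cite: Andre1996Motifs, §6.3 Lemmes 6.3.1–6.3.3] [cite: BrosnanFangNiePearlstein2009, §6 Lemma 48]
[cite: Fulton1998, §10.1 Cor. 10.1] [cite: Pridham2024Semiregularity, Cor. 2.25 and Rem. 2.27] [cite: GortzWedhorn2023, Thm. 27.291] -/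
theorem hc_av_of_twAtDiag_ge (hC : Theses.VHCAbelianSchemesRoad.ChernCharacterOnBetti) (M₀ : ℕ)
    (hDiag : ∀ (C : ChernCharacterBetti) (m : ℕ), M₀ ≤ m →
      LefAtExceptionalRegimeAt (Literature.AlgebraicGeometry.HodgeTheory.twistedReflexiveClass C
        (fun n X₀ I E => Summit.Ventures.HSemireg.gluableSigmaAdmissible n X₀ I E ∨
          Literature.AlgebraicGeometry.HodgeTheory.bfSingleAdmissible n X₀ I E)) (2 * m) m)
    (hDoor : Theses.VHCAbelianSchemesRoad.TwistedPerfectDoor) (hR : Theses.VHCAbelianSchemesRoad.RaynaudSectionProjective)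
    (h₂₁ : Theses.VHCAbelianSchemesRoad.AndreCMAnchoredPencil) (h₂₂ : Theses.VHCAbelianSchemesRoad.AndreAnchoredPencilsAlgebraic) :
    Theses.PadicSemiregularLift.HodgeAbelianVarieties :=
  hc_av_of_exceptionalRegimeAt_twisted_diagonal_ge hC admTw_of_bfSingle' M₀ hDiag hDoor hR h₂₁ h₂₂

/-- **`HC_AV` from the binders of `closes` with the crux replaced by «regime 2 at INFINITELY MANY diagonal cells»** (per Chern character
theory: `∀ C M, ∃ m ≥ M, LefAtExceptionalRegimeAt (twisted door C) (2m) m`) — the weakest diagonal statement the road's engine consumes;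
FACT-FREE beyond the route decls. [cite: Andre1996Motifs, §6.3 Lemmes 6.3.1–6.3.3] [cite: BrosnanFangNiePearlstein2009, §6 Lemma 48]
[cite: Fulton1998, §10.1 Cor. 10.1] [cite: Pridham2024Semiregularity, Cor. 2.25 and Rem. 2.27] [cite: GortzWedhorn2023, Thm. 27.291] -/
theorem hc_av_of_twAtDiag_frequently (hC : Theses.VHCAbelianSchemesRoad.ChernCharacterOnBetti)
    (hDiag : ∀ (C : ChernCharacterBetti) (M : ℕ), ∃ m : ℕ, M ≤ m ∧
      LefAtExceptionalRegimeAt (Literature.AlgebraicGeometry.HodgeTheory.twistedReflexiveClass C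
        (fun n X₀ I E => Summit.Ventures.HSemireg.gluableSigmaAdmissible n X₀ I E ∨
          Literature.AlgebraicGeometry.HodgeTheory.bfSingleAdmissible n X₀ I E)) (2 * m) m)
    (hDoor : Theses.VHCAbelianSchemesRoad.TwistedPerfectDoor) (hR : Theses.VHCAbelianSchemesRoad.RaynaudSectionProjective)
    (h₂₁ : Theses.VHCAbelianSchemesRoad.AndreCMAnchoredPencil) (h₂₂ : Theses.VHCAbelianSchemesRoad.AndreAnchoredPencilsAlgebraic) :
    Theses.PadicSemiregularLift.HodgeAbelianVarieties :=
  hc_av_of_exceptionalRegimeAt_twisted_diagonal_frequently hC admTw_of_bfSingle' hDiag hDoor hR h₂₁ h₂₂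

/-- **`HC_AV` from the option-(α) candidate skeleton's TAIL STUB statement ALONE** (`stub_diagonalTailTw : ∀ C m, 4 ≤ m → …`, LEAD gen 149
`bc/TwAtDiag_birth_candidate.lean`) and the other five binders — the stubs `stub_firstCell_fourfoldMiddleTw` `(4, 2)` and
`stub_rung_sixfoldMiddleTw` `(6, 3)` are not needed for the leaf. [cite: Andre1996Motifs, §6.3 Lemmes 6.3.1–6.3.3]
[cite: BrosnanFangNiePearlstein2009, §6 Lemma 48] [cite: Fulton1998, §10.1 Cor. 10.1] -/
theorem hc_av_of_twAtDiagTail_four (hC : Theses.VHCAbelianSchemesRoad.ChernCharacterOnBetti)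
    (hTail : ∀ (C : ChernCharacterBetti) (m : ℕ), 4 ≤ m →
      LefAtExceptionalRegimeAt (Literature.AlgebraicGeometry.HodgeTheory.twistedReflexiveClass C
        (fun n X₀ I E => Summit.Ventures.HSemireg.gluableSigmaAdmissible n X₀ I E ∨
          Literature.AlgebraicGeometry.HodgeTheory.bfSingleAdmissible n X₀ I E)) (2 * m) m)
    (hDoor : Theses.VHCAbelianSchemesRoad.TwistedPerfectDoor) (hR : Theses.VHCAbelianSchemesRoad.RaynaudSectionProjective)
    (h₂₁ : Theses.VHCAbelianSchemesRoad.AndreCMAnchoredPencil) (h₂₂ : Theses.VHCAbelianSchemesRoad.AndreAnchoredPencilsAlgebraic) :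
    Theses.PadicSemiregularLift.HodgeAbelianVarieties :=
  hc_av_of_twAtDiag_ge hC 4 hTail hDoor hR h₂₁ h₂₂

/-! ## §3 What `HC_CM` buys: `HCAtDim g` from ONE cell -/

/-- **`HCAtDim g` from the route decls `ChernCharacterOnBetti`, `TwistedPerfectDoor`, `RaynaudSectionProjective`, `AndreCMAnchoredPencil`,
the cell's `HC_CM` (`Theses.RankFourFaces.CMAbelianHodge`) and regime 2 over the twisted door at ONE diagonal cell `(2M, M)` with
`M + 2 ≥ 2g`** — no `AndreAnchoredPencilsAlgebraic`. E.g. abelian sixfolds from `HC_CM` and the single cell `(20, 10)`.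
[cite: Andre1996Motifs, Lemme 6.3.1 (p. 31)] [cite: Abdulali1994FamiliesAV, Lemma 6.2] [cite: Milne1999, §7]
[cite: Pridham2024Semiregularity, Cor. 2.25 and Rem. 2.27] [cite: GortzWedhorn2023, Thm. 27.291] -/
theorem hcAtDim_of_cmAbelianHodge_of_twAtCell (hC : Theses.VHCAbelianSchemesRoad.ChernCharacterOnBetti)
    (hCM : Theses.RankFourFaces.CMAbelianHodge) (g : ℕ) {M : ℕ} (hM : 2 * g ≤ M + 2)
    (hcell : ∀ C : ChernCharacterBetti,
      LefAtExceptionalRegimeAt (Literature.AlgebraicGeometry.HodgeTheory.twistedReflexiveClass C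
        (fun n X₀ I E => Summit.Ventures.HSemireg.gluableSigmaAdmissible n X₀ I E ∨
          Literature.AlgebraicGeometry.HodgeTheory.bfSingleAdmissible n X₀ I E)) (2 * M) M)
    (hDoor : Theses.VHCAbelianSchemesRoad.TwistedPerfectDoor) (hR : Theses.VHCAbelianSchemesRoad.RaynaudSectionProjective)
    (h₂₁ : Theses.VHCAbelianSchemesRoad.AndreCMAnchoredPencil) : HCAtDim g :=
  hcAtDim_of_HC_CM_of_exceptionalRegimeAt_twisted_cellAbove hC admTw_of_bfSingle' g hM hcell hDoor hR h₂₁ fun A₀ _ => hCM A₀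

/-! ## §4 The ROUND-2 crux BY NAME (route rev 13/14, item stmt-HodgeConjecture-19787): the diagonal crux ⟹ every tail ⟹ infinitely many cells

(appended after the LEAD's option-(α) edit of 2026-08-26T22:1xZ; §§1–3 byte-identical). The leaf from the crux by name is the route's own
`closes` (rev 13+) and is not restated; through the tail it reads `hc_av_of_twAtDiag_ge hC 4 (twAtDiag_ge_of_semiregularSheafRepresentativesTwAtDiag h 4) …`. -/

/-- **The round-2 crux `SemiregularSheafRepresentativesTwAtDiag` (item 19787: all diagonal cells `m ≥ 2`) implies EVERY tail `m ≥ M₀`** — for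
`M₀ ≤ 1` the extra cells `(0, 0)`, `(2, 1)` lie off the middle range and hold outright (`lefAtExceptionalRegimeAt_of_offMidRange`, part W). C → S
bookkeeping for the tribunal: each tail is a WEAKER hypothesis than the crux; none is claimed equivalent to it.
[cite: Bloch1972Semiregularity, Remark (7.5)] [cite: BuchweitzFlenner2003, §5 Thm. 5.1] [cite: VoisinHodgeI2002, Thm. 11.30] -/
theorem twAtDiag_ge_of_semiregularSheafRepresentativesTwAtDiag
    (h : Theses.VHCAbelianSchemesRoad.SemiregularSheafRepresentativesTwAtDiag) (M₀ : ℕ) :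
    ∀ (C : ChernCharacterBetti) (m : ℕ), M₀ ≤ m →
      LefAtExceptionalRegimeAt (Literature.AlgebraicGeometry.HodgeTheory.twistedReflexiveClass C
        (fun n X₀ I E => Summit.Ventures.HSemireg.gluableSigmaAdmissible n X₀ I E ∨
          Literature.AlgebraicGeometry.HodgeTheory.bfSingleAdmissible n X₀ I E)) (2 * m) m := by
  intro C m _
  rcases Nat.lt_or_ge m 2 with hm | hm
  · exact lefAtExceptionalRegimeAt_of_offMidRange _ (Or.inl (by omega))
  · exact h C m hm

/-- **The round-2 crux implies «regime 2 at infinitely many diagonal cells»** (per Chern character theory) — the weakest statement of this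
shape the road's engine consumes (`hc_av_of_twAtDiag_frequently`). [cite: Bloch1972Semiregularity, Remark (7.5)] [cite: BuchweitzFlenner2003, §5 Thm. 5.1] -/
theorem twAtDiag_frequently_of_semiregularSheafRepresentativesTwAtDiag
    (h : Theses.VHCAbelianSchemesRoad.SemiregularSheafRepresentativesTwAtDiag) :
    ∀ (C : ChernCharacterBetti) (M : ℕ), ∃ m : ℕ, M ≤ m ∧
      LefAtExceptionalRegimeAt (Literature.AlgebraicGeometry.HodgeTheory.twistedReflexiveClass C
        (fun n X₀ I E => Summit.Ventures.HSemireg.gluableSigmaAdmissible n X₀ I E ∨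
          Literature.AlgebraicGeometry.HodgeTheory.bfSingleAdmissible n X₀ I E)) (2 * m) m :=
  twAtDiag_frequently_of_ge (twAtDiag_ge_of_semiregularSheafRepresentativesTwAtDiag h 2)

/-- **`HCAtDim g` from the round-2 crux BY NAME, `HC_CM` and four of the other binders** (no `AndreAnchoredPencilsAlgebraic`): the single cell
`(2M, M)`, `M = 2g + 2` (any `M ≥ max(2, 2g − 2)` would do), of the crux serves dimension `g` (§3). What `HC_CM` buys on the edited route,
per dimension.
[cite: Andre1996Motifs, Lemme 6.3.1 (p. 31)] [cite: Abdulali1994FamiliesAV, Lemma 6.2] [cite: Milne1999, §7] -/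
theorem hcAtDim_of_cmAbelianHodge_of_semiregularSheafRepresentativesTwAtDiag (hC : Theses.VHCAbelianSchemesRoad.ChernCharacterOnBetti)
    (hCM : Theses.RankFourFaces.CMAbelianHodge) (hDiag : Theses.VHCAbelianSchemesRoad.SemiregularSheafRepresentativesTwAtDiag)
    (hDoor : Theses.VHCAbelianSchemesRoad.TwistedPerfectDoor) (hR : Theses.VHCAbelianSchemesRoad.RaynaudSectionProjective)
    (h₂₁ : Theses.VHCAbelianSchemesRoad.AndreCMAnchoredPencil) (g : ℕ) : HCAtDim g :=
  hcAtDim_of_cmAbelianHodge_of_twAtCell hC hCM g (M := 2 * g + 2) (by omega)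
    (fun C => twAtDiag_ge_of_semiregularSheafRepresentativesTwAtDiag hDiag 2 C (2 * g + 2) (by omega)) hDoor hR h₂₁

end Summit.HodgeConjecture.HodgeConjecture.Ring2.SemiregularRepresentatives

end
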